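import Summits.CriticalPhenomena.PercolationContinuityZ3.Theorems.Transplant.FreeSubmonoidExpGrowth
import Mathlib.GroupTheory.RegularWreathProduct
import HarnessLib

/-!
# `θ(p_c) = 0` on EVERY Cayley graph of EVERY lamplighter group `C ≀ ℤ` — the amenable exponential-growth example, a concrete kernel customer (unconditional)

builds on p205010 (kernel theorem, internal audit signed; external expert review pending) — nothing in this file uses p205010; unconditional, no node.
Lane `prim-bschramm`, seat `prim-bschramm-p4` gen 22 (PART C3 of `P4-GENERAL.md` §44).  Helper file (`--supports stmt-CriticalPhenomena-4575 --as helper`).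

THE POINT.  The lamplighter groups are AMENABLE of EXPONENTIAL growth — exactly the case of Conjecture 4 that Benjamini–Lyons–Peres–Schramm (nonamenable)
does not cover and Hutchcroft 2016 does.  Here they enter the C3 class map as concrete kernel customers through the free-pair certificate
(`FreePair.criticalContinuity`, gen 22): inside Mathlib's regular wreath product `D ≀ᵣ ℤ` (`RegularWreathProduct D (Multiplicative ℤ)`) take the shift
`t = (1, 1)` and the "toggle-then-shift" `v = (δ₀^d, 1)` for a lamp state `d ≠ 1`; the lamplighter group is `Lamp d = ⟨t, v⟩` (`= ⟨d⟩ ≀ ℤ`, the classical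
`ℤ₂ ≀ ℤ` for `D = ℤ/2`).  Positive words in `t, v` are pairwise distinct (the word is read off the lamp configuration: `posWord_injective`, by peeling
the first letter off position `0` and cancelling), so **`Lamp.criticalContinuity_anyGens`: for every finite generating set `S` of `Lamp d` and every
vertex `g`, `θ_g(p_c(Cay(Lamp d; S))) = 0`**, unconditionally; exponential growth `Lamp.hasExponentialGrowth_anyGens`; `p_c < 1` by
`ExpGrowth.criticalProb_lt_one_of_hasExponentialGrowth`.
[cite: LyonsPeres2016, §7.4 (lamplighter groups; Thm. 7.20)] [cite: Hutchcroft2016, Thm. 1 (amenable groups of exponential growth)] [cite: BenjaminiSchramm1996, Conj. 4]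
-/

noncomputable section

namespace Summit.CriticalPhenomena.PercolationContinuityZ3.Theorems.Transplant
open SimpleGraph Literature.Probability.LatticeModels Literature.Probability.Percolation
open scoped Classical

namespace Lamp

variable {D : Type} [Group D]

/-- The shift `t = (1, +1)`. [folklore] -/
def shift : D ≀ᵣ Multiplicative ℤ := ⟨1, Multiplicative.ofAdd 1⟩

/-- Toggle the lamp at the lamplighter's position to state `d`, then shift: `v = (δ₀^d, +1)`. [folklore] -/
def toggleShift (d : D) : D ≀ᵣ Multiplicative ℤ := ⟨Pi.mulSingle (Multiplicative.ofAdd 0) d, Multiplicative.ofAdd 1⟩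

/-- The letter of a Boolean: `true ↦ t`, `false ↦ v`. [folklore] -/
def letter (d : D) (b : Bool) : D ≀ᵣ Multiplicative ℤ := if b then shift else toggleShift d

/-- Both letters shift by `+1`. [folklore] -/
@[simp] theorem letter_right (d : D) (b : Bool) : (letter d b).right = Multiplicative.ofAdd 1 := by
  cases b <;> rfl

/-- The lamp function of a letter away from position `0` is trivial. [folklore] -/
theorem letter_left_of_ne (d : D) (b : Bool) {j : ℤ} (hj : j ≠ 0) : (letter d b).left (Multiplicative.ofAdd j) = 1 := by
  cases b
  · show (Pi.mulSingle (Multiplicative.ofAdd (0 : ℤ)) d : Multiplicative ℤ → D) (Multiplicative.ofAdd j) = 1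
    rw [Pi.mulSingle_apply, if_neg (fun h => hj (Multiplicative.ofAdd.injective h))]
  · rfl

/-- The lamp function of a letter at position `0`: `d` for `v`, `1` for `t`. [folklore] -/
theorem letter_left_zero (d : D) (b : Bool) : (letter d b).left (Multiplicative.ofAdd 0) = if b then 1 else d := by
  cases b
  · show (Pi.mulSingle (Multiplicative.ofAdd (0 : ℤ)) d : Multiplicative ℤ → D) (Multiplicative.ofAdd 0) = d
    exact Pi.mulSingle_eq_same _ _
  · rfl

/-- The lamplighter's position after a positive word is its length. [folklore] -/
theorem posWord_right (d : D) : ∀ w : List Bool, ((w.map (letter d)).prod).right = Multiplicative.ofAdd (w.length : ℤ)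
  | [] => by simp
  | b :: w => by
    rw [List.map_cons, List.prod_cons, RegularWreathProduct.mul_right, posWord_right d w, letter_right, List.length_cons, ← ofAdd_add]
    congr 1; push_cast; ring

/-- A positive word never lights a lamp at a negative position. [folklore] -/
theorem posWord_left_neg (d : D) : ∀ (w : List Bool) {j : ℤ}, j < 0 → ((w.map (letter d)).prod).left (Multiplicative.ofAdd j) = 1
  | [], j, _ => by simp
  | b :: w, j, hj => by
    rw [List.map_cons, List.prod_cons, RegularWreathProduct.mul_left, Pi.mul_apply, letter_left_of_ne d b hj.ne, one_mul, letter_right,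
      show (Multiplicative.ofAdd (1 : ℤ))⁻¹ * Multiplicative.ofAdd j = Multiplicative.ofAdd (j - 1) by
        rw [← ofAdd_neg, ← ofAdd_add]; congr 1; ring]
    exact posWord_left_neg d w (by omega)

/-- The lamp at position `0` after a non-empty positive word records the FIRST letter. [folklore] -/
theorem posWord_left_zero_cons (d : D) (b : Bool) (w : List Bool) :
    (((b :: w).map (letter d)).prod).left (Multiplicative.ofAdd 0) = if b then 1 else d := by
  rw [List.map_cons, List.prod_cons, RegularWreathProduct.mul_left, Pi.mul_apply, letter_left_zero, letter_right,
    show (Multiplicative.ofAdd (1 : ℤ))⁻¹ * Multiplicative.ofAdd (0 : ℤ) = Multiplicative.ofAdd (-1) by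
      rw [← ofAdd_neg, ← ofAdd_add]; congr 1,
    posWord_left_neg d w (by norm_num), mul_one]

/-- **`t` and `v` generate a free submonoid** (for a lamp state `d ≠ 1`): positive words are pairwise distinct. [folklore] -/
theorem posWord_injective {d : D} (hd : d ≠ 1) : Function.Injective fun w : List Bool => (w.map (letter d)).prod := by
  intro w
  induction w with
  | nil =>
    intro w' h
    cases w' with
    | nil => rfl
    | cons b w' =>
      exfalso
      have hr := congrArg RegularWreathProduct.right h
      simp only [List.map_nil, List.prod_nil, RegularWreathProduct.one_right] at hr
      rw [posWord_right] at hr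
      have := congrArg Multiplicative.toAdd hr
      simp at this
      omega
  | cons b w ih =>
    intro w' h
    cases w' with
    | nil =>
      exfalso
      have hr := congrArg RegularWreathProduct.right h
      simp only [List.map_nil, List.prod_nil, RegularWreathProduct.one_right] at hr
      rw [posWord_right] at hr
      have := congrArg Multiplicative.toAdd hr
      simp at this
      omega
    | cons b' w' =>
      have h' : ((b :: w).map (letter d)).prod = ((b' :: w').map (letter d)).prod := h
      -- the first letters agree: read the lamp at position 0
      have hb : b = b' := by
        have h0 := congrArg (fun x : D ≀ᵣ Multiplicative ℤ => x.left (Multiplicative.ofAdd 0)) h'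
        simp only [posWord_left_zero_cons] at h0
        cases b <;> cases b' <;> simp_all
      subst hb
      -- cancel the first letter
      rw [List.map_cons, List.map_cons, List.prod_cons, List.prod_cons] at h'
      have h'' := mul_left_cancel h'
      rw [ih h'']

variable (d : D)

/-- **The lamplighter group over `⟨d⟩`**: the subgroup of `D ≀ᵣ ℤ` generated by the shift and the toggle-shift (finitely supported lamp
configurations over the cyclic group `⟨d⟩`, with the lamplighter's position; `ℤ₂ ≀ ℤ` for `D = ℤ/2`, `d = 1 mod 2`). [cite: LyonsPeres2016, §7.4 (lamplighter group)] -/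
abbrev Grp : Subgroup (D ≀ᵣ Multiplicative ℤ) := Subgroup.closure {shift, toggleShift d}

/-- The letters lie in the lamplighter group. [folklore] -/
theorem letter_mem (b : Bool) : letter d b ∈ Grp d := by
  cases b
  · exact Subgroup.subset_closure (Set.mem_insert_of_mem _ rfl)
  · exact Subgroup.subset_closure (Set.mem_insert _ _)

/-- The letters as elements of the lamplighter group, and the free pair inside it. [folklore] -/
theorem posWord_injective_grp {d : D} (hd : d ≠ 1) :
    Function.Injective fun w : List Bool => (w.map fun b => if b then (⟨shift, letter_mem d true⟩ : Grp d) else ⟨toggleShift d, letter_mem d false⟩).prod := by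
  intro w w' h
  apply posWord_injective hd
  have key : ∀ w : List Bool, (((w.map fun b => if b then (⟨shift, letter_mem d true⟩ : Grp d) else ⟨toggleShift d, letter_mem d false⟩).prod :
      Grp d) : D ≀ᵣ Multiplicative ℤ) = (w.map (letter d)).prod := by
    intro w
    rw [SubmonoidClass.coe_list_prod, List.map_map]
    congr 1
    apply List.map_congr_left
    intro b _
    cases b <;> rfl
  have h' := congrArg (fun x : Grp d => (x : D ≀ᵣ Multiplicative ℤ)) h
  simp only [key] at h'
  exact h'

/-- **Every Cayley graph of every lamplighter group has exponential growth.** [cite: LyonsPeres2016, §7.4 Thm. 7.20] -/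
theorem hasExponentialGrowth_anyGens {d : D} (hd : d ≠ 1) (S : Finset (Grp d)) (hS : Subgroup.closure (S : Set (Grp d)) = ⊤) :
    Literature.Barriers.CriticalPhenomena.HasExponentialGrowth (mulCayley (↑S : Set (Grp d))) :=
  FreePair.hasExponentialGrowth S hS (posWord_injective_grp hd)

/-- **THEOREM (unconditional, kernel): `θ_g(p_c) = 0` on every Cayley graph of every lamplighter group `⟨d⟩ ≀ ℤ`** — every finite generating set,
every vertex (amenable, exponential growth: Hutchcroft 2016 Thm. 1, PROVED in the tree). [cite: Hutchcroft2016, Thm. 1] [cite: BenjaminiSchramm1996, Conj. 4] -/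
theorem criticalContinuity_anyGens {d : D} (hd : d ≠ 1) (S : Finset (Grp d)) (hS : Subgroup.closure (S : Set (Grp d)) = ⊤) (g : Grp d) :
    theta (mulCayley (↑S : Set (Grp d))) g (criticalProbIOf (mulCayley (↑S : Set (Grp d))) g) = 0 :=
  FreePair.criticalContinuity S hS (posWord_injective_grp hd) g

end Lamp

end Summit.CriticalPhenomena.PercolationContinuityZ3.Theorems.Transplant
end
-- build-touch 2026-08-25T07:55:49Z T1-B (lead g18): re-land of p391691, declarations byte-identical
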